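import Summits.Ventures.YMGap.Census.WindowLadder
import HarnessLib

/-!
# Venture YMGap, track (b) — all decimation windows of `(ℤ/bLℤ)^d` integrate exactly
# (the `2`-dimensional integrations of Tomboulis's Prop. III.1, arXiv:0707.2179 §2.1 (RG2)–(RG3))

HONEST FRAMING: venture file of the cell `pub-ymgap` (QuantumFields programme), track (b); exact character calculus on
finite tori.  Nothing here concerns (5.15), limits, confinement or a mass gap.

`WindowLadder.integral_windowProd_mul` integrates out the `2b(b-1)` interior links of ONE window in the presence of a
spectator not reading them; `WindowLinks` says that the other windows (merged or not) are such spectators.  Processing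
the windows one by one (`integral_windowFn_eq_prod_mergedFace`):
`∫ ∏_{P} ∏_{s,t<b} Σ_m A_m χ_m(U_{(P,s,t)}) ∏ dU = ∫ ∏_{P} Σ_m A_m^{b²}/(m+1)^{b²-1} χ_m(H^P_0 V^P_b (H^P_b)⁻¹ (V^P_0)⁻¹) ∏ dU`
— after the interior integrations every coarse plaquette carries one character sum of its boundary word (Tomboulis:
"This merges the `b²` tiling plaquettes into a single plaquette of side length `ba`. These integrations are exact").

References: E. T. Tomboulis, arXiv:0707.2179 §2.1 [cite: Tomboulis2007Confinement, §2.1 (RG2)–(RG3)]; A. A. Migdal,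
Sov. Phys. JETP 42 (1975) 413 [folklore].
-/

noncomputable section

open MeasureTheory Finset Real Function
open scoped BigOperators
open Literature.MathematicalPhysics.QuantumLattice
open Literature.MathematicalPhysics.QuantumFieldTheory
open Literature.MathematicalPhysics.QuantumFieldTheory.Tomboulis2007
open Summit.Ventures.LatticeQCDFlow.Exactness
open Summit.Ventures.LatticeQCDFlow.Scoring

namespace Summit.Ventures.YMGap.Census

variable {d L b : ℕ} [NeZero b] [NeZero L]

/-! ### The window integrand as a product of windows -/

omit [NeZero b] in
/-- `windowFn = ∏_P windowProd_P`. -/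
theorem windowFn_eq_prod_windowProd (K : ℕ) (A : ℕ → ℝ) (W : GaugeConfig d (b * L) SU2) :
    windowFn (L := L) b K A W = ∏ P : Plaquette d L, windowProd b K A P W := by
  unfold windowFn windowProd rowProd
  rw [Fintype.prod_prod_type]
  refine Finset.prod_congr rfl fun P _ => ?_
  rw [Fintype.prod_prod_type]
  simp_rw [← faceSum_base_eq_faceW]
  rw [Finset.prod_comm]
  rw [← Fin.prod_univ_eq_prod_range (fun t => ∏ s ∈ Finset.range b,
    faceSum K A (plaquetteHolonomy W (base b P s t) P.2.1.1 P.2.1.2)) b]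
  refine Finset.prod_congr rfl fun t _ => ?_
  exact (Fin.prod_univ_eq_prod_range (fun s => faceSum K A (plaquetteHolonomy W (base b P s t) P.2.1.1 P.2.1.2)) b)

/-! ### The other windows do not read the interior links of a window -/

/-- The interior links of the window of `P`: `v_{k,t}`, `h_{s,k}` with `1 ≤ k < b` (`s, t < b`) are read by no
other window — as a hypothesis shape on a link `E` (bookkeeping). -/
theorem interior_spec {P : Plaquette d L} {E : Edge d (b * L)}
    (hE : (∃ k t, 1 ≤ k ∧ k < b ∧ t < b ∧ E = vLink b P k t) ∨ (∃ s k, s < b ∧ 1 ≤ k ∧ k < b ∧ E = hLink b P s k))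
    {P' : Plaquette d L} (hP' : P' ≠ P) :
    (∀ s' t', s' < b → t' ≤ b → hLink b P' s' t' ≠ E) ∧ (∀ s'' t', s'' ≤ b → t' < b → vLink b P' s'' t' ≠ E) := by
  rcases hE with ⟨k, t, hk1, hkb, ht, rfl⟩ | ⟨s, k, hs, hk1, hkb, rfl⟩
  · exact ⟨fun s' t' _ _ => hLink_ne_vLink_interior hk1 hkb,
      fun s'' t' hs'' ht' => vLink_ne_vLink_interior hP' hs'' ht' hk1 hkb ht⟩
  · exact ⟨fun s' t' hs' ht' => hLink_ne_hLink_interior hP' hs' ht' hs hk1 hkb,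
      fun s'' t' _ _ => vLink_ne_hLink_interior hk1 hkb⟩

/-! ### Processing the windows one by one -/

/-- The spectator of window `P` while the windows in `S` are merged and the others not (bookkeeping). -/
def winSpec (K : ℕ) (A : ℕ → ℝ) (S : Finset (Plaquette d L)) (P : Plaquette d L) (W : GaugeConfig d (b * L) SU2) : ℝ :=
  (∏ P' ∈ S, mergedFace b K A P' W) * ∏ P' ∈ (Finset.univ \ S).erase P, windowProd b K A P' W

/-- `winSpec` is continuous. -/
theorem continuous_winSpec (K : ℕ) (A : ℕ → ℝ) (S : Finset (Plaquette d L)) (P : Plaquette d L) :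
    Continuous (winSpec (b := b) K A S P) :=
  (continuous_finsetProd _ fun P' _ => continuous_mergedFace K A P').mul
    (continuous_finsetProd _ fun P' _ => continuous_windowProd K A P')

/-- `winSpec` does not read the interior links of the window of `P` (`P ∉ S`). -/
theorem winSpec_update (K : ℕ) (A : ℕ → ℝ) {S : Finset (Plaquette d L)} {P : Plaquette d L} (hP : P ∉ S)
    {E : Edge d (b * L)}
    (hE : (∃ k t, 1 ≤ k ∧ k < b ∧ t < b ∧ E = vLink b P k t) ∨ (∃ s k, s < b ∧ 1 ≤ k ∧ k < b ∧ E = hLink b P s k))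
    (W : GaugeConfig d (b * L) SU2) (g : SU2) : winSpec K A S P (update W E g) = winSpec K A S P W := by
  have h1 : ∏ P' ∈ S, mergedFace b K A P' (update W E g) = ∏ P' ∈ S, mergedFace b K A P' W := by
    refine Finset.prod_congr rfl fun P' hP'S => ?_
    have h := interior_spec hE (P' := P') (fun h => hP (h ▸ hP'S))
    exact mergedFace_update K A P' h.1 h.2 W g
  have h2 : ∏ P' ∈ (Finset.univ \ S).erase P, windowProd b K A P' (update W E g) =
      ∏ P' ∈ (Finset.univ \ S).erase P, windowProd b K A P' W := by
    refine Finset.prod_congr rfl fun P' hP' => ?_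
    have h := interior_spec hE (P' := P') (Finset.mem_erase.1 hP').1
    exact windowProd_update K A P' h.1 h.2 W g
  unfold winSpec
  rw [h1, h2]

omit [NeZero b] in
/-- Isolating window `P` before merging it (bookkeeping). -/
theorem winSpec_before (K : ℕ) (A : ℕ → ℝ) {S : Finset (Plaquette d L)} {P : Plaquette d L} (hP : P ∉ S)
    (W : GaugeConfig d (b * L) SU2) :
    (∏ P' ∈ S, mergedFace b K A P' W) * (∏ P' ∈ Finset.univ \ S, windowProd b K A P' W) =
      windowProd b K A P W * winSpec K A S P W := by
  have hmem : P ∈ Finset.univ \ S := Finset.mem_sdiff.2 ⟨Finset.mem_univ _, hP⟩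
  unfold winSpec
  rw [← Finset.mul_prod_erase _ _ hmem]
  ring

omit [NeZero b] in
/-- Window `P` after merging it (bookkeeping). -/
theorem winSpec_after (K : ℕ) (A : ℕ → ℝ) {S : Finset (Plaquette d L)} {P : Plaquette d L} (hP : P ∉ S)
    (W : GaugeConfig d (b * L) SU2) :
    (∏ P' ∈ insert P S, mergedFace b K A P' W) * (∏ P' ∈ Finset.univ \ insert P S, windowProd b K A P' W) =
      mergedFace b K A P W * winSpec K A S P W := by
  have hsd : Finset.univ \ insert P S = (Finset.univ \ S).erase P := by
    ext x
    simp only [Finset.mem_sdiff, Finset.mem_univ, true_and, Finset.mem_insert, Finset.mem_erase, not_or]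
  unfold winSpec
  rw [Finset.prod_insert hP, hsd]
  ring

/-- **All windows integrate exactly** (arXiv:0707.2179 §2.1 (RG2)–(RG3) on the whole torus):
`∫ windowFn = ∫ ∏_P mergedFace_P`. -/
theorem integral_windowFn_eq_prod_mergedFace (K : ℕ) (A : ℕ → ℝ) :
    ∫ W, windowFn (L := L) b K A W ∂(Measure.pi fun _ : Edge d (b * L) => haarProbability SU2) =
      ∫ W, ∏ P : Plaquette d L, mergedFace b K A P W ∂(Measure.pi fun _ : Edge d (b * L) => haarProbability SU2) := by
  suffices h : ∀ S : Finset (Plaquette d L),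
      ∫ W, windowFn (L := L) b K A W ∂(Measure.pi fun _ : Edge d (b * L) => haarProbability SU2) =
        ∫ W, (∏ P ∈ S, mergedFace b K A P W) * (∏ P ∈ Finset.univ \ S, windowProd b K A P W)
          ∂(Measure.pi fun _ : Edge d (b * L) => haarProbability SU2) by
    rw [h Finset.univ]
    simp only [Finset.sdiff_self, Finset.prod_empty, mul_one]
  intro S
  induction S using Finset.induction_on with
  | empty =>
    simp only [Finset.prod_empty, Finset.sdiff_empty, one_mul, windowFn_eq_prod_windowProd]
  | insert P S hP ih =>
    rw [ih]
    simp_rw [winSpec_before K A hP, winSpec_after K A hP]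
    refine integral_windowProd_mul K A P ?_ ?_ (continuous_winSpec K A S P)
    · intro k t hk1 hkb ht W g
      exact winSpec_update K A hP (Or.inl ⟨k, t, hk1, hkb, ht, rfl⟩) W g
    · intro s k hs hk1 hkb W g
      exact winSpec_update K A hP (Or.inr ⟨s, k, hs, hk1, hkb, rfl⟩) W g

end Summit.Ventures.YMGap.Census

end
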